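import Summits.NavierStokesRegularity.NavierStokesRegularity.Theorems.RecurrentProfilesRecurrentReductionOrbit
import Literature.Analysis.FluidPDE.ScalingUniformRecurrence
import HarnessLib

/-!
# Crux `ForcedSymmetry` (stmt-NavierStokesRegularity-4052), line `closing-dichotomy` (gen c10.1) —
# stub `stub_hullSensitive`: orbit-sensitivity propagates over a minimal hull

Theorems-only file (no definitions, no named facts).  Notation: `ℝ³ = EuclideanSpace ℝ (Fin 3)`
(local).  Write `Φ_r W = nsRescale (exp r) W` for the Navier–Stokes scaling flow in
logarithmic time, `‖F‖_K = eLpNorm (fun z => F z.1 z.2) 3 (volume.restrict K)` for the `L³(K)`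
seminorm, `Q₁ = Q(0,1)`, "`W ∈ L³_loc`" for `W ∈ L³(Q(0,R))` for all `R > 0`, and "`B` is a hull
point of `A`" for: for every `ε > 0` and every compact `K ⊆ {t ≤ 0} × ℝ³` some orbit point `Φ_τ A`
is within `ε` of `B` in `L³(K)`.

**Statement.**  Let `U ∈ L³_loc`, `δ > 0`; assume the hull of `U` is MINIMAL (every `L³_loc` hull
point `V` of `U` has `U` as a hull point) and `U` is ORBIT-SENSITIVE at itself with constant `δ`
on `Q₁` (every `L³_loc`-neighbourhood of `U` contains an orbit point `Φ_σ U` and a log-time `s`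
with `‖Φ_σ (Φ_s U) − Φ_s U‖_{Q₁} > δ`).  Then every hull point `V ∈ L³_loc` of `U` is
orbit-sensitive at itself with constant `δ/2` on `Q₁` — the Auslander–Yorke / Akin–Auslander–Berg
argument "a minimal system with a non-equicontinuity point is sensitive at every point", written
out with `eLpNorm` inequalities and the exact `L³` scaling law; no topology, no compactness, no
Navier–Stokes input.

**Proof.**  If not, some `ε₀ > 0`, compact `K₀` satisfy (*) `‖Φ_σ V − V‖_{K₀} ≤ ε₀ ⇒ ∀ s,
‖Φ_σ (Φ_s V) − Φ_s V‖_{Q₁} ≤ δ/2`.  (A) By minimality `U`, hence every `Φ_c U`, `Φ_c (Φ_d U)`, is a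
hull point of `V` (hull clause on the dilated compact set, `ε` corrected by the exact scaling
constant).  (B) Closure form of (*): a hull point `W ∈ L³_loc` of `V` with `‖W − V‖_{K₀} ≤ ε₀/2`
has `‖Φ_r W − Φ_r V‖_{Q₁} ≤ δ/2` for all `r` (approximate `W` by `Φ_τ V` on `K₀` and on
`Φ_{e^r}([-1,0] × B̄₁)` at once, fire (*) at `σ = τ`, fixed-time continuity of `Φ_r`, `η → 0`).
(C)–(D) Pick `s₀` with `‖Φ_{s₀} U − V‖_{K₀} ≤ ε₀/4`; sensitivity of `U` on `Φ_{e^{s₀}} K₀` gives `σ, s`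
with `‖Φ_{s₀} (Φ_σ U) − Φ_{s₀} U‖_{K₀} ≤ ε₀/4` and `‖Φ_σ (Φ_s U) − Φ_s U‖_{Q₁} > δ`.  (E) The hull
points `Φ_{s₀} U`, `Φ_{s₀} (Φ_σ U)` of `V` are within `ε₀/2` of `V` on `K₀`; (B) at `r = s − s₀` puts
`Φ_s U` and `Φ_σ (Φ_s U)` within `δ/2` of `Φ_r V` in `L³(Q₁)`, hence within `δ` of each other —
contradiction.  References: Auslander–Yorke, Tôhoku Math. J. 32 (1980), Thm. 1 and Cor.
[AuslanderYorke1980]; Akin–Auslander–Berg, *When is a transitive map chaotic?* (1996), Thm. 2.4–2.5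
[AkinAuslanderBerg1996]; Glasner, *Ergodic Theory via Joinings* (2003), Thm. 1.41 [Glasner2003].
-/

noncomputable section

-- the sub-problem namespace repeats the summit name (D-0017 layout `Summit.<S>.<P>.Theorems`)
set_option linter.dupNamespace false

namespace Summit.NavierStokesRegularity.NavierStokesRegularity.Theorems

open MeasureTheory Set Function Filter Topology TopologicalSpace Metric
open Literature.Analysis Literature.Analysis.FluidPDE
open scoped NNReal ENNReal

/-- Local notation for physical space `ℝ³ = EuclideanSpace ℝ (Fin 3)` (the registered stub
signature is spelled with it). -/
local notation "ℝ³" => EuclideanSpace ℝ (Fin 3)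

/-! ### Bookkeeping of the scaling flow -/

/-- Action law in logarithmic time: `Φ_a (Φ_b W) = Φ_{a+b} W` (`nsRescale_mul`, `Real.exp_add`).
[folklore] -/
private theorem hullSens_exp_add (a b : ℝ)
    (W : ℝ → ℝ³ → ℝ³) :
    nsRescale (Real.exp a) (nsRescale (Real.exp b) W) = nsRescale (Real.exp (a + b)) W := by
  rw [Real.exp_add, mul_comm (Real.exp a), nsRescale_mul]

/-- `L³_loc` is invariant under the rescalings `W ↦ W_c`, `c > 0` (`memLp_three_zoom`).
[folklore] -/
private theorem hullSens_memLp_nsRescale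
    {W : ℝ → ℝ³ → ℝ³}
    (hW : ∀ R : ℝ, 0 < R → MemLp (uncurry W) 3 (volume.restrict (parabolicCylinder R 0)))
    {c : ℝ} (hc : 0 < c) :
    ∀ R : ℝ, 0 < R → MemLp (uncurry (nsRescale c W)) 3 (volume.restrict (parabolicCylinder R 0)) := by
  -- adapted from `hPz` in `recurrentReduction_proof`
  intro R hR
  rw [nsRescale_eq_zoom]
  exact memLp_three_zoom hc (hW (c * R) (mul_pos hc hR))

/-- **Transport of an `L³` upper bound through the exact scaling law**: for `c > 0`, `ε > 0`
there is `ε' > 0` such that `‖F − G‖_{L³(Φ_c K)} ≤ ε'` implies `‖F_c − G_c‖_{L³(K)} ≤ ε`, for all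
fields `F, G` and sets `K` (`eLpNorm_nsRescale_restrict`, `ε' = ε / (c (c⁵)^{-1/3})`). [folklore] -/
private theorem hullSens_transport {c : ℝ} (hc : 0 < c) {ε : ℝ} (hε : 0 < ε) :
    ∃ ε' : ℝ, 0 < ε' ∧
      ∀ (F G : ℝ → ℝ³ → ℝ³)
        (K : Set (ℝ × ℝ³)),
      eLpNorm (fun z => F z.1 z.2 - G z.1 z.2) 3
          (volume.restrict (stAffine (c ^ 2) c 0 (0 : ℝ³) '' K)) ≤
        ENNReal.ofReal ε' →
      eLpNorm (fun z => nsRescale c F z.1 z.2 - nsRescale c G z.1 z.2) 3 (volume.restrict K) ≤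
        ENNReal.ofReal ε := by
  -- adapted from `IsScalingUniformlyRecurrent.nsRescale` (ScalingUniformRecurrence)
  set A : ℝ≥0∞ := ‖c‖ₑ *
    (ENNReal.ofReal (c ^ 2 * c ^ Module.finrank ℝ ℝ³)⁻¹) ^
      (1 / (3 : ℝ≥0∞)).toReal with hA
  have hAtop : A ≠ ⊤ := ENNReal.mul_ne_top enorm_ne_top
    (ENNReal.rpow_ne_top_of_nonneg (by norm_num) ENNReal.ofReal_ne_top)
  have hA0 : A ≠ 0 := mul_ne_zero (by simpa using hc.ne')
    (ENNReal.rpow_pos (ENNReal.ofReal_pos.2 (by positivity)) ENNReal.ofReal_ne_top).ne'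
  have hApos : 0 < A.toReal := ENNReal.toReal_pos hA0 hAtop
  refine ⟨ε / A.toReal, div_pos hε hApos, fun F G K h => ?_⟩
  have h1 : (fun z : ℝ × ℝ³ => nsRescale c F z.1 z.2 - nsRescale c G z.1 z.2)
      = fun z : ℝ × ℝ³ => nsRescale c (F - G) z.1 z.2 := by
    rw [nsRescale_sub]; rfl
  rw [h1, eLpNorm_nsRescale_restrict hc, ← hA]
  calc A * eLpNorm (fun z => (F - G) z.1 z.2) 3
        (volume.restrict (stAffine (c ^ 2) c 0 (0 : ℝ³) '' K))
      ≤ A * ENNReal.ofReal (ε / A.toReal) := mul_le_mul' le_rfl h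
    _ = ENNReal.ofReal ε := by
      rw [← ENNReal.ofReal_toReal hAtop, ← ENNReal.ofReal_mul hApos.le,
        ENNReal.toReal_ofReal hApos.le, mul_div_cancel₀ _ hApos.ne']

/-- **Hull points are permuted by the flow** (Step A): if `X` is a hull point of `V`, so is
`Φ_c X` for every `c` (`Φ_{c+τ} V − Φ_c X = Φ_c (Φ_τ V − X)` and the transport lemma on the
dilated compact set `Φ_{e^c} K ⊆ {t ≤ 0} × ℝ³`). [folklore] -/
private theorem hullSens_hull_nsRescale
    {V X : ℝ → ℝ³ → ℝ³}
    (h : ∀ ε : ℝ, 0 < ε → ∀ K : Set (ℝ × ℝ³), IsCompact K →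
      K ⊆ Set.Iic (0 : ℝ) ×ˢ Set.univ → ∃ τ : ℝ,
        eLpNorm (fun z => nsRescale (Real.exp τ) V z.1 z.2 - X z.1 z.2) 3 (volume.restrict K) ≤
          ENNReal.ofReal ε)
    (c : ℝ) :
    ∀ ε : ℝ, 0 < ε → ∀ K : Set (ℝ × ℝ³), IsCompact K →
      K ⊆ Set.Iic (0 : ℝ) ×ˢ Set.univ → ∃ τ : ℝ,
        eLpNorm (fun z => nsRescale (Real.exp τ) V z.1 z.2 - nsRescale (Real.exp c) X z.1 z.2) 3
          (volume.restrict K) ≤ ENNReal.ofReal ε := by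
  intro ε hε K hK hKH
  obtain ⟨ε', hε', hT⟩ := hullSens_transport (Real.exp_pos c) hε
  obtain ⟨τ, hτ⟩ := h ε' hε' _ (hK.image (continuous_stAffine _ _ _ _))
    (image_stAffine_sq_subset_Iic_prod_univ _ hKH)
  refine ⟨c + τ, ?_⟩
  rw [← hullSens_exp_add]
  exact hT _ _ K hτ

/-! ### Measurability on compact subsets of the closed half-space -/

/-- A compact `K ⊆ {t ≤ 0} × ℝ³` lies in some `Q(0, n+1)` up to the null hyperplane
`{t = 0} × ℝ³`, as an inequality of restricted measures. [folklore] -/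
private theorem hullSens_restrict_le {K : Set (ℝ × ℝ³)} (hK : IsCompact K)
    (hKH : K ⊆ Set.Iic (0 : ℝ) ×ˢ Set.univ) :
    ∃ n : ℕ, (volume.restrict K : Measure (ℝ × ℝ³)) ≤
      volume.restrict (parabolicCylinder ((n : ℝ) + 1) 0) := by
  -- adapted from `exists_eLpNorm_restrict_le_of_isCompact` (RecurrentProfilesRecurrentReductionOrbit)
  obtain ⟨R, hR⟩ := hK.isBounded.subset_closedBall (0 : ℝ × ℝ³)
  obtain ⟨n, hn⟩ := exists_nat_ge R
  set Q₀ : Set (ℝ × ℝ³) := parabolicCylinder ((n : ℝ) + 1) 0 with hQ₀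
  set N : Set (ℝ × ℝ³) :=
    ({0} : Set ℝ) ×ˢ (univ : Set ℝ³) with hN
  have hsub : K ⊆ Q₀ ∪ N := by
    intro z hz
    have hzR : ‖z‖ ≤ R := by simpa [mem_closedBall, dist_zero_right] using hR hz
    have h1 : |z.1| ≤ R := (norm_fst_le z).trans hzR
    have h2 : ‖z.2‖ ≤ R := (norm_snd_le z).trans hzR
    have hz0 : z.1 ≤ 0 := (hKH hz).1
    rcases hz0.lt_or_eq with hlt | heq
    · left
      rw [hQ₀, SuitableCompactness.mem_parabolicCylinder_zero]
      refine ⟨⟨?_, hlt⟩, by linarith⟩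
      nlinarith [n.cast_nonneg (α := ℝ), (abs_le.1 h1).1]
    · exact Or.inr ⟨heq, mem_univ _⟩
  have hnull : volume N = 0 := by
    rw [hN, Measure.volume_eq_prod, Measure.prod_prod, Real.volume_singleton, zero_mul]
  have hae : (Q₀ ∪ N : Set (ℝ × ℝ³)) =ᵐ[volume] Q₀ := by
    have h := (ae_eq_refl Q₀).union (ae_eq_empty.2 hnull)
    rwa [union_empty] at h
  exact ⟨n, (Measure.restrict_mono hsub le_rfl).trans_eq (Measure.restrict_congr_set hae)⟩

/-- An `L³_loc` field is a.e.-strongly measurable on compact `K ⊆ {t ≤ 0} × ℝ³`. [folklore] -/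
private theorem hullSens_aesm {W : ℝ → ℝ³ → ℝ³}
    (hW : ∀ R : ℝ, 0 < R → MemLp (uncurry W) 3 (volume.restrict (parabolicCylinder R 0)))
    {K : Set (ℝ × ℝ³)} (hK : IsCompact K)
    (hKH : K ⊆ Set.Iic (0 : ℝ) ×ˢ Set.univ) :
    AEStronglyMeasurable (fun z => W z.1 z.2) (volume.restrict K) := by
  obtain ⟨n, hn⟩ := hullSens_restrict_le hK hKH
  exact (hW ((n : ℝ) + 1) (by positivity)).1.mono_measure hn

/-- An `L³_loc` field is a.e.-strongly measurable on `Q(0,1)`. [folklore] -/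
private theorem hullSens_aesm_one {W : ℝ → ℝ³ → ℝ³}
    (hW : ∀ R : ℝ, 0 < R → MemLp (uncurry W) 3 (volume.restrict (parabolicCylinder R 0))) :
    AEStronglyMeasurable (fun z => W z.1 z.2) (volume.restrict (parabolicCylinder 1 0)) :=
  (hW 1 one_pos).1

/-! ### `L³` triangle inequalities -/

/-- Triangle inequality `‖A − C‖ ≤ ‖A − B‖ + ‖B − C‖` in `L³(μ)` for a.e.-strongly measurable
fields. [folklore] -/
private theorem hullSens_triangle {μ : Measure (ℝ × ℝ³)}
    (A B C : ℝ → ℝ³ → ℝ³)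
    (hA : AEStronglyMeasurable (fun z => A z.1 z.2) μ)
    (hB : AEStronglyMeasurable (fun z => B z.1 z.2) μ)
    (hC : AEStronglyMeasurable (fun z => C z.1 z.2) μ) :
    eLpNorm (fun z => A z.1 z.2 - C z.1 z.2) 3 μ ≤
      eLpNorm (fun z => A z.1 z.2 - B z.1 z.2) 3 μ + eLpNorm (fun z => B z.1 z.2 - C z.1 z.2) 3 μ := by
  have e : (fun z : ℝ × ℝ³ => A z.1 z.2 - C z.1 z.2) =
      (fun z : ℝ × ℝ³ => A z.1 z.2 - B z.1 z.2) +
        fun z : ℝ × ℝ³ => B z.1 z.2 - C z.1 z.2 := by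
    funext z
    simp only [Pi.add_apply, sub_add_sub_cancel]
  rw [e]
  exact eLpNorm_add_le (hA.sub hB) (hB.sub hC) (by norm_num)

/-- Symmetry `‖A − B‖ = ‖B − A‖` of the `L³(μ)` distance. [folklore] -/
private theorem hullSens_sub_comm (A B : ℝ → ℝ³ → ℝ³)
    (μ : Measure (ℝ × ℝ³)) :
    eLpNorm (fun z => A z.1 z.2 - B z.1 z.2) 3 μ = eLpNorm (fun z => B z.1 z.2 - A z.1 z.2) 3 μ :=
  eLpNorm_sub_comm (fun z : ℝ × ℝ³ => A z.1 z.2)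
    (fun z : ℝ × ℝ³ => B z.1 z.2) 3 μ

/-! ### Step B: the closure form of orbit-equicontinuity -/

/-- **Closure form of an orbit-equicontinuity neighbourhood** (Step B).  Suppose
(*) `‖Φ_σ V − V‖_{K₀} ≤ ε₀ ⇒ ∀ s, ‖Φ_σ (Φ_s V) − Φ_s V‖_{Q₁} ≤ b`.  If `W ∈ L³_loc` is a hull point
of `V ∈ L³_loc` with `‖W − V‖_{K₀} ≤ ε₀/2`, then `‖Φ_r W − Φ_r V‖_{Q₁} ≤ b` for every `r`: for
`η > 0` approximate `W` by `Φ_τ V` within `min (ε₀/2) η'` on `K₀ ∪ Φ_{e^r}([-1,0] × B̄(0,1))`; then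
(*) fires at `σ = τ`, `‖Φ_r W − Φ_r (Φ_τ V)‖_{Q₁} ≤ η` (transport lemma) and `Φ_r Φ_τ = Φ_τ Φ_r`;
let `η → 0`. [cite: AkinAuslanderBerg1996, Thm. 2.4] -/
private theorem hullSens_closure {V W : ℝ → ℝ³ → ℝ³}
    {ε₀ : ℝ} {K₀ : Set (ℝ × ℝ³)} {b : ℝ≥0∞}
    (hV : ∀ R : ℝ, 0 < R → MemLp (uncurry V) 3 (volume.restrict (parabolicCylinder R 0)))
    (hW : ∀ R : ℝ, 0 < R → MemLp (uncurry W) 3 (volume.restrict (parabolicCylinder R 0)))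
    (hK₀ : IsCompact K₀) (hK₀H : K₀ ⊆ Set.Iic (0 : ℝ) ×ˢ Set.univ) (hε₀ : 0 < ε₀)
    (hstar : ∀ σ : ℝ, eLpNorm (fun z => nsRescale (Real.exp σ) V z.1 z.2 - V z.1 z.2) 3
        (volume.restrict K₀) ≤ ENNReal.ofReal ε₀ → ∀ s : ℝ,
      eLpNorm (fun z => nsRescale (Real.exp σ) (nsRescale (Real.exp s) V) z.1 z.2 -
        nsRescale (Real.exp s) V z.1 z.2) 3 (volume.restrict (parabolicCylinder 1 0)) ≤ b)
    (hVW : ∀ ε : ℝ, 0 < ε → ∀ K : Set (ℝ × ℝ³), IsCompact K →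
      K ⊆ Set.Iic (0 : ℝ) ×ˢ Set.univ → ∃ τ : ℝ,
        eLpNorm (fun z => nsRescale (Real.exp τ) V z.1 z.2 - W z.1 z.2) 3 (volume.restrict K) ≤
          ENNReal.ofReal ε)
    (hWV : eLpNorm (fun z => W z.1 z.2 - V z.1 z.2) 3 (volume.restrict K₀) ≤
      ENNReal.ofReal (ε₀ / 2))
    (r : ℝ) :
    eLpNorm (fun z => nsRescale (Real.exp r) W z.1 z.2 - nsRescale (Real.exp r) V z.1 z.2) 3
      (volume.restrict (parabolicCylinder 1 0)) ≤ b := by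
  refine ENNReal.le_of_forall_pos_le_add fun η hη _ => ?_
  obtain ⟨η', hη', hT⟩ := hullSens_transport (Real.exp_pos r) (NNReal.coe_pos.2 hη)
  -- a compact neighbourhood `[-1, 0] × B̄(0, 1)` of `Q₁` in the closed half-space, its dilation
  set Kc : Set (ℝ × ℝ³) :=
    Set.Icc (-1 : ℝ) 0 ×ˢ Metric.closedBall (0 : ℝ³) 1 with hKc_def
  have hKc : IsCompact Kc := isCompact_Icc.prod (isCompact_closedBall _ _)
  have hKcH : Kc ⊆ Set.Iic (0 : ℝ) ×ˢ Set.univ :=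
    Set.prod_mono Set.Icc_subset_Iic_self (Set.subset_univ _)
  have hQKc : parabolicCylinder 1 0 ⊆ Kc := by
    intro z hz
    rw [SuitableCompactness.mem_parabolicCylinder_zero] at hz
    simp only [one_pow] at hz
    exact ⟨⟨hz.1.1.le, hz.1.2.le⟩, mem_closedBall_zero_iff.2 hz.2.le⟩
  set Kr : Set (ℝ × ℝ³) :=
    stAffine (Real.exp r ^ 2) (Real.exp r) 0 (0 : ℝ³) '' Kc with hKr_def
  have hKr : IsCompact Kr := hKc.image (continuous_stAffine _ _ _ _)
  have hKrH : Kr ⊆ Set.Iic (0 : ℝ) ×ˢ Set.univ := image_stAffine_sq_subset_Iic_prod_univ _ hKcH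
  -- approximate `W` by an orbit point of `V` on both compact sets at once
  obtain ⟨τ, hτ⟩ := hVW (min (ε₀ / 2) η') (lt_min (by positivity) hη') _ (hK₀.union hKr)
    (Set.union_subset hK₀H hKrH)
  have hτ₀ : eLpNorm (fun z => nsRescale (Real.exp τ) V z.1 z.2 - W z.1 z.2) 3
      (volume.restrict K₀) ≤ ENNReal.ofReal (ε₀ / 2) :=
    (eLpNorm_mono_measure _ (Measure.restrict_mono Set.subset_union_left le_rfl)).trans
      (hτ.trans (ENNReal.ofReal_le_ofReal (min_le_left _ _)))
  have hτr : eLpNorm (fun z => W z.1 z.2 - nsRescale (Real.exp τ) V z.1 z.2) 3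
      (volume.restrict (stAffine (Real.exp r ^ 2) (Real.exp r) 0 (0 : ℝ³) ''
        parabolicCylinder 1 0)) ≤ ENNReal.ofReal η' := by
    rw [hullSens_sub_comm]
    exact (eLpNorm_mono_measure _ (Measure.restrict_mono (Set.image_mono hQKc) le_rfl)).trans
      ((eLpNorm_mono_measure _ (Measure.restrict_mono Set.subset_union_right le_rfl)).trans
        (hτ.trans (ENNReal.ofReal_le_ofReal (min_le_right _ _))))
  -- (*) fires at `σ = τ`
  have h1 : eLpNorm (fun z => nsRescale (Real.exp τ) V z.1 z.2 - V z.1 z.2) 3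
      (volume.restrict K₀) ≤ ENNReal.ofReal ε₀ :=
    calc _ ≤ _ := hullSens_triangle _ _ _
            (hullSens_aesm (hullSens_memLp_nsRescale hV (Real.exp_pos τ)) hK₀ hK₀H)
            (hullSens_aesm hW hK₀ hK₀H) (hullSens_aesm hV hK₀ hK₀H)
      _ ≤ ENNReal.ofReal (ε₀ / 2) + ENNReal.ofReal (ε₀ / 2) := add_le_add hτ₀ hWV
      _ = ENNReal.ofReal ε₀ := by
          rw [← ENNReal.ofReal_add (by positivity) (by positivity), add_halves]
  have h2 := hstar τ h1 r
  -- fixed-time continuity of `Φ_r`: `‖Φ_r W − Φ_r (Φ_τ V)‖_{Q₁} ≤ η`, and `Φ_r Φ_τ = Φ_τ Φ_r`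
  have h3 := hT W (nsRescale (Real.exp τ) V) _ hτr
  rw [nsRescale_comm (Real.exp r) (Real.exp τ) V, ENNReal.ofReal_coe_nnreal] at h3
  calc _ ≤ _ := hullSens_triangle _ _ _
          (hullSens_aesm_one (hullSens_memLp_nsRescale hW (Real.exp_pos r)))
          (hullSens_aesm_one (hullSens_memLp_nsRescale
            (hullSens_memLp_nsRescale hV (Real.exp_pos r)) (Real.exp_pos τ)))
          (hullSens_aesm_one (hullSens_memLp_nsRescale hV (Real.exp_pos r)))
    _ ≤ η + b := add_le_add h3 h2
    _ = b + η := add_comm _ _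

/-! ### The registered stub -/

/-- **Stub `stub_hullSensitive`** (registered stub of crux stmt-NavierStokesRegularity-4052, line
`closing-dichotomy`, gen c10.1; known type): **orbit-sensitivity propagates over a minimal hull
with half the constant.**  Hypotheses: `U ∈ L³_loc`, `δ > 0`; the hull of `U` is minimal (every
`L³_loc` hull point `V` of `U` has `U` as a hull point); `U` is orbit-sensitive at itself with
constant `δ` on `Q(0,1)`.  Conclusion: every hull point `V ∈ L³_loc` of `U` is orbit-sensitive at
itself with constant `δ/2` on `Q(0,1)` (Auslander–Yorke / Akin–Auslander–Berg: "minimal and not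
equicontinuous ⇒ sensitive at every point", in `L³_loc`): an orbit-equicontinuity neighbourhood
`{‖· − V‖_{K₀} ≤ ε₀}` of `V` (modulus `δ/2`) would, by its closure form `hullSens_closure`, control
the hull points `Φ_{s₀} U`, `Φ_{s₀} (Φ_σ U)` of `V` inside it (density of the orbit of `U`, sensitivity
of `U` on `Φ_{e^{s₀}} K₀`), contradicting `‖Φ_σ (Φ_s U) − Φ_s U‖_{Q(0,1)} > δ`.  No NS input.
[cite: AuslanderYorke1980, Thm. 1 and Cor.; AkinAuslanderBerg1996, Thm. 2.4–2.5; Glasner2003, Thm. 1.41] -/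
theorem stub_hullSensitive :
    ∀ (U : ℝ → ℝ³ → ℝ³) (δ : ℝ), 0 < δ →
      (∀ R : ℝ, 0 < R → MemLp (uncurry U) 3 (volume.restrict (parabolicCylinder R (0 : ℝ × ℝ³)))) →
      (∀ V : ℝ → ℝ³ → ℝ³,
        (∀ R : ℝ, 0 < R → MemLp (uncurry V) 3 (volume.restrict (parabolicCylinder R (0 : ℝ × ℝ³)))) →
        (∀ ε : ℝ, 0 < ε → ∀ K : Set (ℝ × ℝ³), IsCompact K → K ⊆ Set.Iic (0 : ℝ) ×ˢ Set.univ →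
          ∃ τ : ℝ, eLpNorm (fun z : ℝ × ℝ³ => nsRescale (Real.exp τ) U z.1 z.2 - V z.1 z.2) 3
            (volume.restrict K) ≤ ENNReal.ofReal ε) →
        ∀ ε : ℝ, 0 < ε → ∀ K : Set (ℝ × ℝ³), IsCompact K → K ⊆ Set.Iic (0 : ℝ) ×ˢ Set.univ →
          ∃ τ : ℝ, eLpNorm (fun z : ℝ × ℝ³ => nsRescale (Real.exp τ) V z.1 z.2 - U z.1 z.2) 3
            (volume.restrict K) ≤ ENNReal.ofReal ε) →
      (∀ ε : ℝ, 0 < ε → ∀ K : Set (ℝ × ℝ³), IsCompact K → K ⊆ Set.Iic (0 : ℝ) ×ˢ Set.univ →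
        ∃ σ : ℝ, eLpNorm (fun z : ℝ × ℝ³ => nsRescale (Real.exp σ) U z.1 z.2 - U z.1 z.2) 3
            (volume.restrict K) ≤ ENNReal.ofReal ε ∧
          ∃ s : ℝ, ENNReal.ofReal δ < eLpNorm (fun z : ℝ × ℝ³ =>
              nsRescale (Real.exp σ) (nsRescale (Real.exp s) U) z.1 z.2 - nsRescale (Real.exp s) U z.1 z.2) 3
            (volume.restrict (parabolicCylinder 1 (0 : ℝ × ℝ³)))) →
      ∀ V : ℝ → ℝ³ → ℝ³,
        (∀ R : ℝ, 0 < R → MemLp (uncurry V) 3 (volume.restrict (parabolicCylinder R (0 : ℝ × ℝ³)))) →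
        (∀ ε : ℝ, 0 < ε → ∀ K : Set (ℝ × ℝ³), IsCompact K → K ⊆ Set.Iic (0 : ℝ) ×ˢ Set.univ →
          ∃ τ : ℝ, eLpNorm (fun z : ℝ × ℝ³ => nsRescale (Real.exp τ) U z.1 z.2 - V z.1 z.2) 3
            (volume.restrict K) ≤ ENNReal.ofReal ε) →
        ∀ ε : ℝ, 0 < ε → ∀ K : Set (ℝ × ℝ³), IsCompact K → K ⊆ Set.Iic (0 : ℝ) ×ˢ Set.univ →
          ∃ σ : ℝ, eLpNorm (fun z : ℝ × ℝ³ => nsRescale (Real.exp σ) V z.1 z.2 - V z.1 z.2) 3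
              (volume.restrict K) ≤ ENNReal.ofReal ε ∧
            ∃ s : ℝ, ENNReal.ofReal (δ / 2) < eLpNorm (fun z : ℝ × ℝ³ =>
                nsRescale (Real.exp σ) (nsRescale (Real.exp s) V) z.1 z.2 - nsRescale (Real.exp s) V z.1 z.2) 3
              (volume.restrict (parabolicCylinder 1 (0 : ℝ × ℝ³))) := by
  intro U δ hδ hU hmin hsens V hV hUV ε₀ hε₀ K₀ hK₀ hK₀H
  by_contra hcon
  -- (*): the orbit-equicontinuity neighbourhood `{‖· − V‖_{K₀} ≤ ε₀}` of `V`, modulus `δ/2`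
  have hstar : ∀ σ : ℝ, eLpNorm (fun z => nsRescale (Real.exp σ) V z.1 z.2 - V z.1 z.2) 3
        (volume.restrict K₀) ≤ ENNReal.ofReal ε₀ → ∀ s : ℝ,
      eLpNorm (fun z => nsRescale (Real.exp σ) (nsRescale (Real.exp s) V) z.1 z.2 -
          nsRescale (Real.exp s) V z.1 z.2) 3 (volume.restrict (parabolicCylinder 1 0)) ≤
        ENNReal.ofReal (δ / 2) := by
    intro σ hσ s
    by_contra h
    exact hcon ⟨σ, hσ, s, not_le.1 h⟩
  -- Step A: by minimality `U` (hence every `Φ_c U`, `Φ_c (Φ_d U)`) is a hull point of `V`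
  have hVU := hmin V hV hUV
  -- Step C: an orbit point `Φ_{s₀} U` of `U` deep inside the neighbourhood
  obtain ⟨s₀, hs₀⟩ := hUV (ε₀ / 4) (by positivity) K₀ hK₀ hK₀H
  -- Step D: sensitivity of `U` on the dilated compact set `Φ_{e^{s₀}} K₀`
  obtain ⟨ε₁, hε₁, hT⟩ :=
    hullSens_transport (Real.exp_pos s₀) (show (0 : ℝ) < ε₀ / 4 by positivity)
  obtain ⟨σ, hσ, s, hs⟩ := hsens ε₁ hε₁ _ (hK₀.image (continuous_stAffine _ _ _ _))
    (image_stAffine_sq_subset_Iic_prod_univ _ hK₀H)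
  have hD : eLpNorm (fun z => nsRescale (Real.exp s₀) (nsRescale (Real.exp σ) U) z.1 z.2 -
      nsRescale (Real.exp s₀) U z.1 z.2) 3 (volume.restrict K₀) ≤ ENNReal.ofReal (ε₀ / 4) :=
    hT _ _ K₀ hσ
  -- Step E: the hull points `W₁ = Φ_{s₀} U`, `W₂ = Φ_{s₀} (Φ_σ U)` of `V` in the neighbourhood
  have hW₁ := hullSens_memLp_nsRescale hU (Real.exp_pos s₀)
  have hW₂ := hullSens_memLp_nsRescale (hullSens_memLp_nsRescale hU (Real.exp_pos σ))
    (Real.exp_pos s₀)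
  have h1 : eLpNorm (fun z => nsRescale (Real.exp s₀) U z.1 z.2 - V z.1 z.2) 3
      (volume.restrict K₀) ≤ ENNReal.ofReal (ε₀ / 2) :=
    hs₀.trans (ENNReal.ofReal_le_ofReal (by linarith))
  have h2 : eLpNorm (fun z => nsRescale (Real.exp s₀) (nsRescale (Real.exp σ) U) z.1 z.2 -
      V z.1 z.2) 3 (volume.restrict K₀) ≤ ENNReal.ofReal (ε₀ / 2) :=
    calc _ ≤ _ := hullSens_triangle _ _ _ (hullSens_aesm hW₂ hK₀ hK₀H)
            (hullSens_aesm hW₁ hK₀ hK₀H) (hullSens_aesm hV hK₀ hK₀H)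
      _ ≤ ENNReal.ofReal (ε₀ / 4) + ENNReal.ofReal (ε₀ / 4) := add_le_add hD hs₀
      _ = ENNReal.ofReal (ε₀ / 2) := by
          rw [← ENNReal.ofReal_add (by positivity) (by positivity)]; congr 1; ring
  -- Step B at `r = s - s₀` for both hull points
  have hB₁ := hullSens_closure hV hW₁ hK₀ hK₀H hε₀ hstar (hullSens_hull_nsRescale hVU s₀) h1
    (s - s₀)
  have hB₂ := hullSens_closure hV hW₂ hK₀ hK₀H hε₀ hstar
    (hullSens_hull_nsRescale (hullSens_hull_nsRescale hVU σ) s₀) h2 (s - s₀)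
  -- `Φ_{s-s₀} W₁ = Φ_s U`, `Φ_{s-s₀} W₂ = Φ_σ (Φ_s U)`
  have e1 : nsRescale (Real.exp (s - s₀)) (nsRescale (Real.exp s₀) U) =
      nsRescale (Real.exp s) U := by
    rw [hullSens_exp_add (s - s₀) s₀, sub_add_cancel]
  have e2 : nsRescale (Real.exp (s - s₀)) (nsRescale (Real.exp s₀) (nsRescale (Real.exp σ) U)) =
      nsRescale (Real.exp σ) (nsRescale (Real.exp s) U) := by
    rw [hullSens_exp_add (s - s₀) s₀, sub_add_cancel, nsRescale_comm]
  rw [e1] at hB₁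
  rw [e2] at hB₂
  -- the two orbits are within `δ` of each other at log-time `s`: contradiction
  refine absurd hs (not_lt.2 ?_)
  calc _ ≤ _ := hullSens_triangle _ _ _
          (hullSens_aesm_one (hullSens_memLp_nsRescale
            (hullSens_memLp_nsRescale hU (Real.exp_pos s)) (Real.exp_pos σ)))
          (hullSens_aesm_one (hullSens_memLp_nsRescale hV (Real.exp_pos (s - s₀))))
          (hullSens_aesm_one (hullSens_memLp_nsRescale hU (Real.exp_pos s)))
    _ ≤ ENNReal.ofReal (δ / 2) + ENNReal.ofReal (δ / 2) :=
        add_le_add hB₂ ((hullSens_sub_comm _ _ _).trans_le hB₁)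
    _ = ENNReal.ofReal δ := by
        rw [← ENNReal.ofReal_add (by positivity) (by positivity), add_halves]

end Summit.NavierStokesRegularity.NavierStokesRegularity.Theorems
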